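import Summits.NavierStokesRegularity.NavierStokesRegularity.Theorems.SoloSalvageWu2026WeakLpAlgebra
import Literature.Analysis.FluidPDE.LerayHopfConcatenation
import HarnessLib

/-!
# `TypeIQuarterGate`: the scar envelope forces the Lorentz (weak-`L³`) bound — slice engine

Helper for the crux `QuarterLawTypeI` (stmt-NavierStokesRegularity-23726), registered line
`lorentz-upgrade` (stubs `stub_lorentzUpgrade` ⟶ `stub_lorentzCount` ⟶ `stub_countQuarterLaw`;
the first is OPEN = item `LorentzUpgradeTypeI` 24108, the other two are landed, p816300 /
p815836).

**Content.** A single slice `v : ℝ³ → ℝ³` in `L²` obeying the scar envelope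
`‖v(x)‖ ≤ C' + Σ_{a ∈ σ} C'/(‖x − a‖ + s)` (`σ` finite, `s ≥ 0`) lies in weak-`L³` with the
SCALE-FREE bound `sup_λ λ³ |{λ < ‖v‖}| ≤ 2 C' ∫‖v‖² + 8 N⁴ C'³ |B(0,1)|` (`N = #σ`),
independent of `s`: low levels `λ ≤ 2C'` are paid by Chebyshev and the energy
(`λ³ · ‖v‖₂²/λ² ≤ 2C' ‖v‖₂²`); high levels `λ > 2C'` force `Σ_a C'/(‖x−a‖+s) > λ/2`, hence
`‖x − a‖ < 2NC'/λ` for some scar `a` — a union of `N` balls of total volume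
`≤ N (2NC'/λ)³ |B(0,1)|` (`eWeakLpPow_three_le_of_envelope`).  Along an unforced Leray–Hopf
solution the energy bound `∫‖u(t)‖² ≤ 2E(u₀)` then turns the scar envelope on `[0,T)` (the
conclusion of `ScarEnvelopeTypeI`, item 23843, and the hypothesis of `EnvelopeQuarterLaw`,
item 23844) into UNIFORMLY BOUNDED weak-`L³` slices on `[0,T)` — verbatim the conclusion of
`LorentzUpgradeTypeI` (item 24108 = the open stub `stub_lorentzUpgrade`):
`lorentzBound_of_envelope`.  The by-name corollary
`FiniteScarsTypeI → ScarEnvelopeTypeI → LorentzUpgradeTypeI` (23842 ∧ 23843 ⟹ 24108 ⟹ 23970 ⟺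
23726 with the landed stubs) is filed separately (it imports the route file).

HONEST FRAMING: pure bookkeeping along a HYPOTHETICAL solution with a hypothetical envelope;
`FiniteScarsTypeI`, `ScarEnvelopeTypeI`, `LorentzUpgradeTypeI`, `QuarterLawTypeI` all remain
OPEN and nothing about Navier–Stokes regularity or blow-up is claimed.

References: Grafakos, *Classical Fourier Analysis* §1.1 (weak `L^p`, Chebyshev); Leray 1934
§31 (energy inequality). [folklore]
-/

-- the problem directory repeats the summit name (`NavierStokesRegularity/NavierStokesRegularity`)
set_option linter.dupNamespace false

noncomputable section

open Set Filter MeasureTheory Topology Metric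
open scoped ENNReal NNReal

namespace Summit.NavierStokesRegularity.NavierStokesRegularity.Theorems

namespace LorentzOfEnvelope

open Literature.Analysis.FluidPDE Literature.Analysis.FunctionSpaces

/-! ### The high levels: superlevel sets sit in `N` balls around the scars -/

/-- Elementary: `m < C/d ↔ d < C/m` for positive `m, d`. [folklore] -/
theorem lt_div_comm {m d C : ℝ} (hm : 0 < m) (hd : 0 < d) : m < C / d ↔ d < C / m := by
  rw [lt_div_iff₀ hd, lt_div_iff₀ hm, mul_comm]

/-- Under the scar envelope `‖v(x)‖ ≤ C' + Σ_{a∈σ} C'/(‖x − a‖ + s)` (`s ≥ 0`), a point where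
`‖v(x)‖ > λ > 2C'` lies within `2 N C'/λ` of some scar (`N = #σ`). [folklore] -/
theorem exists_mem_ball_of_envelope {v : EuclideanSpace ℝ (Fin 3) → EuclideanSpace ℝ (Fin 3)}
    {σ : Finset (EuclideanSpace ℝ (Fin 3))} {C' s lam : ℝ} (hs : 0 ≤ s)
    (henv : ∀ x, ‖v x‖ ≤ C' + ∑ a ∈ σ, C' / (‖x - a‖ + s)) (hlam : 2 * C' < lam)
    (hlam0 : 0 < lam) {x : EuclideanSpace ℝ (Fin 3)} (hx : lam < ‖v x‖) :
    ∃ a ∈ σ, x ∈ ball a (2 * σ.card * C' / lam) := by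
  have hsum : lam / 2 < ∑ a ∈ σ, C' / (‖x - a‖ + s) := by linarith [henv x]
  -- `σ` is nonempty (an empty sum is `0 < λ/2`)
  have hne : σ.Nonempty := by
    rw [Finset.nonempty_iff_ne_empty]
    rintro rfl
    rw [Finset.sum_empty] at hsum
    linarith
  have hN : (0 : ℝ) < σ.card := by exact_mod_cast hne.card_pos
  -- pigeonhole: some term exceeds the mean `λ/(2N)`
  have hlt : ∑ a ∈ σ, lam / (2 * σ.card) < ∑ a ∈ σ, C' / (‖x - a‖ + s) := by
    rw [Finset.sum_const, nsmul_eq_mul]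
    have : (σ.card : ℝ) * (lam / (2 * σ.card)) = lam / 2 := by field_simp
    linarith
  obtain ⟨a, ha, hlt⟩ := Finset.exists_lt_of_sum_lt hlt
  refine ⟨a, ha, ?_⟩
  have hmean : 0 < lam / (2 * σ.card) := by positivity
  -- the denominator is positive (else the term is the junk value `0`)
  have hden : 0 < ‖x - a‖ + s := by
    rcases (add_nonneg (norm_nonneg (x - a)) hs).eq_or_lt with h | h
    · rw [← h, div_zero] at hlt; linarith
    · exact h
  rw [mem_ball, dist_eq_norm]
  rw [lt_div_comm hmean hden] at hlt
  -- `hlt : ‖x - a‖ + s < C' / (λ/(2N))`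
  have : C' / (lam / (2 * σ.card)) = 2 * σ.card * C' / lam := by
    field_simp
  linarith [norm_nonneg (x - a)]

/-- The superlevel set `{λ < ‖v‖}` at a level `λ > 2C'` is covered by the balls `B(a, 2NC'/λ)`,
`a ∈ σ`. [folklore] -/
theorem superlevel_subset_cores {v : EuclideanSpace ℝ (Fin 3) → EuclideanSpace ℝ (Fin 3)}
    {σ : Finset (EuclideanSpace ℝ (Fin 3))} {C' s lam : ℝ} (hs : 0 ≤ s)
    (henv : ∀ x, ‖v x‖ ≤ C' + ∑ a ∈ σ, C' / (‖x - a‖ + s)) (hlam : 2 * C' < lam)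
    (hlam0 : 0 < lam) :
    {x | lam < ‖v x‖} ⊆ ⋃ a ∈ σ, ball a (2 * σ.card * C' / lam) := by
  intro x hx
  obtain ⟨a, ha, hxa⟩ := exists_mem_ball_of_envelope hs henv hlam hlam0 hx
  exact mem_biUnion ha hxa

/-- Volume of the cores: `|⋃_{a ∈ σ} B(a, ρ)| ≤ #σ · ρ³ · |B(0,1)|` (`ρ ≥ 0`). [folklore] -/
theorem volume_cores_le (σ : Finset (EuclideanSpace ℝ (Fin 3))) {ρ : ℝ} (hρ : 0 ≤ ρ) :
    volume (⋃ a ∈ σ, ball a ρ) ≤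
      ENNReal.ofReal (σ.card * ρ ^ 3) * volume (ball (0 : EuclideanSpace ℝ (Fin 3)) 1) := by
  calc volume (⋃ a ∈ σ, ball a ρ) ≤ ∑ a ∈ σ, volume (ball a ρ) := measure_biUnion_finset_le σ _
    _ = ∑ a ∈ σ, ENNReal.ofReal (ρ ^ 3) * volume (ball (0 : EuclideanSpace ℝ (Fin 3)) 1) := by
        refine Finset.sum_congr rfl fun a _ => ?_
        rw [Measure.addHaar_ball volume a hρ, finrank_euclideanSpace_fin, ENNReal.ofReal_pow hρ]
    _ = ENNReal.ofReal (σ.card * ρ ^ 3) * volume (ball (0 : EuclideanSpace ℝ (Fin 3)) 1) := by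
        rw [Finset.sum_const, nsmul_eq_mul, ENNReal.ofReal_mul (Nat.cast_nonneg _),
          ENNReal.ofReal_natCast, mul_assoc]

/-! ### The low levels: Chebyshev against the energy -/

/-- Chebyshev at a real level: `λ² |{λ < ‖v‖}| ≤ ∫ ‖v‖²` (`λ > 0`). [folklore] -/
theorem sq_mul_meas_superlevel_le_lintegral
    {v : EuclideanSpace ℝ (Fin 3) → EuclideanSpace ℝ (Fin 3)} (hv : AEStronglyMeasurable v volume)
    {lam : ℝ} (hlam : 0 < lam) :
    ENNReal.ofReal (lam ^ 2) * volume {x | lam < ‖v x‖} ≤ ∫⁻ x, ‖v x‖ₑ ^ 2 := by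
  have hsub : {x | lam < ‖v x‖} ⊆ {x | ENNReal.ofReal (lam ^ 2) ≤ ‖v x‖ₑ ^ 2} := by
    intro x hx
    simp only [mem_setOf_eq] at hx ⊢
    rw [← ofReal_norm, ← ENNReal.ofReal_pow (norm_nonneg _)]
    exact ENNReal.ofReal_le_ofReal (by nlinarith [norm_nonneg (v x)])
  calc ENNReal.ofReal (lam ^ 2) * volume {x | lam < ‖v x‖}
      ≤ ENNReal.ofReal (lam ^ 2) * volume {x | ENNReal.ofReal (lam ^ 2) ≤ ‖v x‖ₑ ^ 2} :=
        mul_le_mul' le_rfl (measure_mono hsub)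
    _ ≤ ∫⁻ x, ‖v x‖ₑ ^ 2 := mul_meas_ge_le_lintegral₀ (hv.enorm.pow_const 2) _

/-! ### The slice bound -/

/-- **Scar envelope ⟹ weak-`L³`, scale-free.** If `v ∈ L²` with `∫ ‖v‖² ≤ E` obeys the scar
envelope `‖v(x)‖ ≤ C' + Σ_{a∈σ} C'/(‖x − a‖ + s)` with `s ≥ 0`, then
`sup_λ λ³ |{λ < ‖v‖}| ≤ 2C'E + 8 N⁴ C'³ |B(0,1)|` (`N = #σ`) — a bound that does not see `s`.
[folklore] -/
theorem eWeakLpPow_three_le_of_envelope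
    {v : EuclideanSpace ℝ (Fin 3) → EuclideanSpace ℝ (Fin 3)} (hv : AEStronglyMeasurable v volume)
    {σ : Finset (EuclideanSpace ℝ (Fin 3))} {C' s E : ℝ} (hs : 0 ≤ s)
    (hE : ∫⁻ x, ‖v x‖ₑ ^ 2 ≤ ENNReal.ofReal E)
    (henv : ∀ x, ‖v x‖ ≤ C' + ∑ a ∈ σ, C' / (‖x - a‖ + s)) :
    eWeakLpPow v 3 volume ≤
      ENNReal.ofReal (2 * C' * E) +
        ENNReal.ofReal (8 * σ.card ^ 4 * C' ^ 3) * volume (ball (0 : EuclideanSpace ℝ (Fin 3)) 1) := by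
  -- `C' ≥ 0`: test the envelope at `x = 0`
  have hC' : 0 ≤ C' := by
    by_contra hneg
    push Not at hneg
    have h := henv 0
    have hsum : ∑ a ∈ σ, C' / (‖(0 : EuclideanSpace ℝ (Fin 3)) - a‖ + s) ≤ 0 :=
      Finset.sum_nonpos fun a _ => div_nonpos_of_nonpos_of_nonneg hneg.le
        (add_nonneg (norm_nonneg _) hs)
    linarith [norm_nonneg (v 0)]
  have h3 : (0 : ℝ) < (3 : ℝ≥0∞).toReal := by norm_num
  refine Wu2026Salvage.eWeakLpPow_le_of_forall h3 fun lam hlam => ?_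
  have e3 : ENNReal.ofReal (lam ^ (3 : ℝ≥0∞).toReal) = ENNReal.ofReal (lam ^ 3) := by
    norm_num
  rw [e3]
  rcases le_or_gt lam (2 * C') with hlow | hhigh
  · -- low level: Chebyshev
    have hcheb := sq_mul_meas_superlevel_le_lintegral hv hlam
    have hsplit : ENNReal.ofReal (lam ^ 3) = ENNReal.ofReal lam * ENNReal.ofReal (lam ^ 2) := by
      rw [← ENNReal.ofReal_mul hlam.le]; ring_nf
    calc ENNReal.ofReal (lam ^ 3) * volume {x | lam < ‖v x‖}
        = ENNReal.ofReal lam * (ENNReal.ofReal (lam ^ 2) * volume {x | lam < ‖v x‖}) := by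
          rw [hsplit, mul_assoc]
      _ ≤ ENNReal.ofReal (2 * C') * ENNReal.ofReal E :=
          mul_le_mul' (ENNReal.ofReal_le_ofReal hlow) (hcheb.trans hE)
      _ = ENNReal.ofReal (2 * C' * E) := (ENNReal.ofReal_mul (by positivity)).symm
      _ ≤ ENNReal.ofReal (2 * C' * E) +
            ENNReal.ofReal (8 * σ.card ^ 4 * C' ^ 3) *
              volume (ball (0 : EuclideanSpace ℝ (Fin 3)) 1) := le_self_add
  · -- high level: the cores
    have hcov := superlevel_subset_cores hs henv hhigh hlam
    have hρ : 0 ≤ 2 * σ.card * C' / lam := by positivity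
    calc ENNReal.ofReal (lam ^ 3) * volume {x | lam < ‖v x‖}
        ≤ ENNReal.ofReal (lam ^ 3) *
            (ENNReal.ofReal (σ.card * (2 * σ.card * C' / lam) ^ 3) *
              volume (ball (0 : EuclideanSpace ℝ (Fin 3)) 1)) :=
          mul_le_mul' le_rfl ((measure_mono hcov).trans (volume_cores_le σ hρ))
      _ = ENNReal.ofReal (8 * σ.card ^ 4 * C' ^ 3) *
            volume (ball (0 : EuclideanSpace ℝ (Fin 3)) 1) := by
          rw [← mul_assoc, ← ENNReal.ofReal_mul (pow_nonneg hlam.le 3)]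
          congr 2
          field_simp
          ring
      _ ≤ ENNReal.ofReal (2 * C' * E) +
            ENNReal.ofReal (8 * σ.card ^ 4 * C' ^ 3) *
              volume (ball (0 : EuclideanSpace ℝ (Fin 3)) 1) := le_add_self

/-! ### Along the solution: envelope + energy ⟹ uniform weak-`L³` slices -/

/-- **Envelope ⟹ Lorentz bound along a Leray–Hopf solution.** If `u` is Leray–Hopf on `[0,T]`
from `u 0` (unforced, `ν ≥ 0`) and obeys the scar envelope
`‖u(t,x)‖ ≤ C' + Σ_{a∈σ} C'/(‖x − a‖ + √(T−t))` on `[0,T)`, then its weak-`L³` slices are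
bounded uniformly on `[0,T)`: `sup_λ λ³|{λ < ‖u(t)‖}| ≤ M'` — the conclusion of
`LorentzUpgradeTypeI`.  The energy bound `∫‖u(t)‖² ≤ 2E(u₀)` (Leray 1934 §31) feeds
`eWeakLpPow_three_le_of_envelope`. [folklore] -/
theorem lorentzBound_of_envelope {ν T : ℝ} (hν : 0 ≤ ν)
    {u : ℝ → EuclideanSpace ℝ (Fin 3) → EuclideanSpace ℝ (Fin 3)}
    (hLH : IsLerayHopfOn T ν 0 (u 0) u)
    (henv : ∃ (σ : Finset (EuclideanSpace ℝ (Fin 3))) (C' : ℝ), ∀ t ∈ Ico 0 T, ∀ x,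
      ‖u t x‖ ≤ C' + ∑ a ∈ σ, C' / (‖x - a‖ + Real.sqrt (T - t))) :
    ∃ M' : ℝ, ∀ t ∈ Ico 0 T, eWeakLpPow (u t) 3 volume ≤ ENNReal.ofReal M' := by
  obtain ⟨σ, C', henv⟩ := henv
  set E : ℝ := 2 * VectorCalculus.kineticEnergy (u 0) with hE_def
  set B : ℝ≥0∞ := ENNReal.ofReal (2 * C' * E) +
    ENNReal.ofReal (8 * σ.card ^ 4 * C' ^ 3) *
      volume (ball (0 : EuclideanSpace ℝ (Fin 3)) 1) with hB_def
  have hBtop : B ≠ ⊤ := by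
    refine ENNReal.add_ne_top.2
      ⟨ENNReal.ofReal_ne_top, ENNReal.mul_ne_top ENNReal.ofReal_ne_top ?_⟩
    exact measure_ball_lt_top.ne
  refine ⟨B.toReal, fun t ht => ?_⟩
  rw [ENNReal.ofReal_toReal hBtop]
  have htI : t ∈ Icc 0 T := Ico_subset_Icc_self ht
  have hmem : MemLp (u t) 2 volume := hLH.memLp t htI
  have hEt : ∫⁻ x, ‖u t x‖ₑ ^ 2 ≤ ENNReal.ofReal E := by
    have h1 : eEnergy (u t) = ENNReal.ofReal (2 * VectorCalculus.kineticEnergy (u t)) :=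
      eEnergy_eq_ofReal _ hmem
    have h2 : VectorCalculus.kineticEnergy (u t) ≤ VectorCalculus.kineticEnergy (u 0) :=
      hLH.kineticEnergy_le_of_zero_force hν htI
    calc ∫⁻ x, ‖u t x‖ₑ ^ 2 = eEnergy (u t) := rfl
      _ = ENNReal.ofReal (2 * VectorCalculus.kineticEnergy (u t)) := h1
      _ ≤ ENNReal.ofReal E := ENNReal.ofReal_le_ofReal (by rw [hE_def]; linarith)
  exact eWeakLpPow_three_le_of_envelope hmem.1 (Real.sqrt_nonneg _) hEt (henv t ht)

/-- The same with `0 < ν` (the route's hypothesis shape), for callers. [folklore] -/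
theorem lorentzBound_of_envelope' (ν T : ℝ) (hν : 0 < ν)
    (u : ℝ → EuclideanSpace ℝ (Fin 3) → EuclideanSpace ℝ (Fin 3))
    (hLH : IsLerayHopfOn T ν 0 (u 0) u)
    (henv : ∃ (σ : Finset (EuclideanSpace ℝ (Fin 3))) (C' : ℝ), ∀ t ∈ Ico 0 T, ∀ x,
      ‖u t x‖ ≤ C' + ∑ a ∈ σ, C' / (‖x - a‖ + Real.sqrt (T - t))) :
    ∃ M' : ℝ, ∀ t ∈ Ico 0 T, eWeakLpPow (u t) 3 volume ≤ ENNReal.ofReal M' :=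
  lorentzBound_of_envelope hν.le hLH henv

end LorentzOfEnvelope

end Summit.NavierStokesRegularity.NavierStokesRegularity.Theorems
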